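/-
Copyright: the b2b-balaban T⁴-continuum CRUX team, row NE7b leaf lineage `t4-ne7b-formalise-leaf-03` (gen 150). Project licence.
-/
import Summits.QuantumFields.BalabanUV.T4Continuum.Spine.NE7b.QuadraticFibreMinimiser
import Summits.QuantumFields.BalabanUV.T4Continuum.Spine.NE7b.TransportedFormCoercivity
import Mathlib.Analysis.Normed.Operator.Bilinear
import Mathlib.Analysis.Calculus.FDeriv.Comp

/-!
# TWO HARD STEPS ARE ONE HARD STEP: the critical section of a blocking `D₁` followed by the critical section of `D₂` for the
# transported form IS the critical section of the composite blocking `D₂ ∘ D₁`, the twice-transported form IS the once-transported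
# form `Q[T₁T₂·, T₁T₂·]`, the composite's critical section FACTORS through the first step's (so the two descriptions coincide by
# uniqueness), and — nonlinearly — a constrained-critical branch of `V ∘ σ₁` over `D₂` composed with the constrained-critical branch
# `σ₁` of `V` over `D₁` is a constrained-critical branch of `V` over `D₂ ∘ D₁`; hence a stretch of the hard-step tower is lettered
# ONCE, on the composite blocking, and the per-step letter losses do NOT compound (row NE7b, node U5c; the hard twin of leaf-04's
# `…SoftStepSemigroup`, the section-level twin of this lineage's value-level `…ConstrainedSchurTower`; [folklore] linear algebra +
# the chain rule)

Cell `pub-balaban`, sub-cell `t4`, spine estimate NE7b (`T4WeightBudget.RelWeightBound`; the cell's OWN estimate — NOT PRINTED in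
[Bałaban 1983–89], NOT PROVED).  Crux-route work under `Spine/NE7b/` by leaf-03 (CRUX team (2), FREEZE (0) crux-prover clause) in the
hard-step cell.  NOTHING of Bałaban's is named, asserted, valued or discharged; no `T4Continuum/Support` leaf typed; no `def`; zero
`sorry`.  Imports: this lineage's BUILT `…QuadraticFibreMinimiser` (QFM: `eq_of_orthogonal_ker`, `propagator_unique`,
`le_of_orthogonal_ker`, `norm_le_of_orthogonal_ker` BY NAME) and `…TransportedFormCoercivity` (TFC: `kerCoercive_bilinearComp_div` BY NAME)
+ Mathlib.  Met BY SHAPE (not imported, nothing restated): leaf-06's `…HardStepInductiveStep` ∕ `…HardStepInductiveStepCritical` (HSIS ∕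
HSIC: one step's output letters — the section letter `D (σ′(w) k) = k`, the constrained criticality `DV(σ w)|_{ker D} = 0`, the next
Hessian `V″(σ w).bilinearComp (σ′ w) (σ′ w)`), leaf-06's `…TransportedHessianEnergyCeiling` (THEC: the size letter through a test
section), this lineage's `…HardStepKKTInductiveStep` (HKIS: the KKT twin), leaf-04's `…SoftStepSemigroup` (two SOFT steps are one).

WHY.  The pricing desk's by-value table F689 (PRICING-NE7b v118) prices the hard-step cell's «unit box» on the exact Gaussian flow:
with the SHARPEST per-step letters the product-of-letters bookkeeping loses a factor ≈ 5.5 per step at the `L = 2` fixed point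
(size ≈ 4.7, coercivity transport 1.155, chart 1.2), and «PRINT's device for the Gaussian part is NOT a per-step letter box: the
quadratic form is carried in CLOSED FORM and bounded UNIFORMLY in `k`» (Dimock, *The renormalization group according to Bałaban I*,
Rev. Math. Phys. 25 (2013), (54), Lemmas 3–5, Lemma 29; [B9] (3.15)–(3.16) «the tower of averagings is one averaging», typed for
print's operators in `Literature.….B9Eq316TowerFlatIsOneStep`).  The abstract reason such a closed form exists is a SEMIGROUP LAW of
the hard step itself, and it holds for the cell's objects verbatim: (§1) if `T₁` is the critical (`Q`-orthogonal-to-`ker D₁`) section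
of `D₁` and `T₂` the critical section of `D₂` for the transported form `Q⁺ = Q[T₁·, T₁·]`, then `T₁ ∘ T₂` is the critical section of
`D₂ ∘ D₁` for `Q`, and `(Q⁺)⁺ = Q[T₁T₂·, T₁T₂·]` on the nose; conversely (§2) ANY map whose values are `Q`-orthogonal to `ker (D₂ ∘ D₁)`
factors through `T₁`, and its push-forward `D₁ ∘ T` is the second step's critical section — so by QFM's uniqueness the two-step and
the one-step descriptions are the same object, with NO Lax–Milgram at the intermediate scale.  Consequently (§3) the letters of a
two-step stretch can be taken ONCE on the composite: the kernel coercivity of `(Q⁺)⁺` on `ker D₃` from a THREE-scale letter of `Q`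
and the norm of `D₂ ∘ D₁` (TFC once — iterating TFC would need a two-scale letter OF `Q⁺`, which letters of `Q` do not supply except
through TFC again, compounding the loss), the size of `(Q⁺)⁺` through ANY test section of the composite blocking (QFM once; THEC's
END at the composite data), and the chart constant `‖T₁ ∘ T₂‖ ≤ (1 + ‖Q‖∕m)‖M₁₂‖` from ANY right inverse `M₁₂` of the composite (QFM
once) instead of the product `K₁·K₁⁺`.  (§4) The same law holds for the NONLINEAR hard step: constrained criticality composes through
the chain rule and the first branch's section letter, so `V ∘ σ₁ ∘ σ₂` is `V` read through ONE constrained-critical branch of the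
composite blocking — the tower's `k`-th action is the fine action at a critical point of the composite fibre, which is how print
DEFINES its background fields.  By iteration (the law applied to `(D₂ ∘ D₁, D₃)`, …) any finite stretch is one step.

WHAT IS PROVED ([folklore]; `E`, `F`, `G`, `G′` real normed spaces — `E` an inner-product space where QFM is invoked —
`Q : E →L E →L ℝ` (NO symmetry: the two orthogonality letters are displayed separately where both are needed), blockings
`D₁ : E →L F`, `D₂ : F →L G`, `D₃ : G →L G′`, sections `T₁ : F →L E`, `T₂ : G →L F`; `Q⁺ := Q.bilinearComp T₁ T₁`):
* §1 COMPOSITION: `section_comp` (`(D₂ ∘ D₁)(T₁ T₂ g) = g`), **`bilinearComp_bilinearComp`** (`(Q.bilinearComp T₁ T₁′).bilinearComp T₂ T₂′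
  = Q.bilinearComp (T₁ ∘ T₂) (T₁′ ∘ T₂′)` — `(Q⁺)⁺` IS the once-transported form), **`orthogonal_ker_comp`** (`T₁` a section with
  `Q (T₁ k)|_{ker D₁} = 0` and `Q⁺ (T₂ g)|_{ker D₂} = 0` ⟹ `Q (T₁ T₂ g)|_{ker (D₂ ∘ D₁)} = 0` — split `x = (x − T₁ D₁ x) + T₁ D₁ x`),
  `orthogonal_ker_comp'` (the second letter `Q · (T₁ T₂ g)` likewise), `twoStep_quad_eq` (`(Q⁺)⁺ g g = Q (T₁T₂ g) (T₁T₂ g)`).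
* §2 UNIQUENESS AND FACTORISATION (QFM BY NAME; `E` inner-product, `Q` `m`-coercive on the relevant kernel):
  **`comp_eq_of_critical`** (any section `H` of `D₂ ∘ D₁` with `Q (H g)|_{ker (D₂ ∘ D₁)} = 0` EQUALS `T₁ ∘ T₂` — QFM `propagator_unique`
  at the composite), **`factor_through_first`** (any `T : G →L E` with `Q (T g)|_{ker (D₂ ∘ D₁)} = 0` satisfies `T = T₁ ∘ (D₁ ∘ T)` —
  QFM `eq_of_orthogonal_ker` on the `D₁`-fibre, coercivity on `ker D₁` only), **`second_section_of_composite`** (for such a section `T`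
  of `D₂ ∘ D₁`, `D₁ ∘ T` is a section of `D₂` and is `Q⁺`-critical: `Q⁺ (D₁ T g)|_{ker D₂} = 0` — the second step's section comes for
  free from the composite's, no Lax–Milgram on `F`).
* §3 ONE-SHOT LETTERS FOR THE TWO-STEP STRETCH: **`kerCoercive_twoStep`** (`Q` `m₃`-coercive on `ker (D₃ ∘ D₂ ∘ D₁)`,
  `‖D₂ D₁ x‖ ≤ d‖x‖`, `0 < d` ⟹ `∀ g, D₃ g = 0 → (m₃∕d²)‖g‖² ≤ (Q⁺)⁺ g g` — TFC `kerCoercive_bilinearComp_div` ONCE at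
  `(D, S, D⁺) := (D₂ ∘ D₁, T₁ ∘ T₂, D₃)`), `norm_comp_comp_le` (the default supplier `d := ‖D₂‖‖D₁‖`),
  **`twoStep_quad_le_of_testSection`** (`Q` symmetric, `≥ 0` on `ker (D₂ ∘ D₁)`, `S` ANY section of `D₂ ∘ D₁` with `Q (S g)(S g) ≤ C‖g‖²`
  ⟹ `(Q⁺)⁺ g g ≤ C‖g‖²` — QFM `le_of_orthogonal_ker` ONCE; THEC's END then gives `‖(Q⁺)⁺‖ ≤ C` in an inner-product `G`),
  **`opNorm_comp_le_of_rightInverse`** (`‖T₁ ∘ T₂‖ ≤ (1 + ‖Q‖∕m)·‖M‖` for ANY right inverse `M` of `D₂ ∘ D₁`, `Q` `m`-coercive on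
  `ker (D₂ ∘ D₁)` — QFM `norm_le_of_orthogonal_ker` ONCE, in place of the product of the two steps' chart constants).
* §4 NONLINEAR — CONSTRAINED CRITICALITY COMPOSES: `fibre_comp` (`D₁ (σ₁ w) = w` on `U₁`, `D₂ (σ₂ g) = g` on `U₂`, `σ₂ (U₂) ⊆ U₁` ⟹
  `(D₂ ∘ D₁)(σ₁ (σ₂ g)) = g`), `section_fderiv_comp` (the composite branch's derivative `σ₁′(σ₂ g) ∘ σ₂′(g)` is a section of `D₂ ∘ D₁`),
  **`critical_comp`** (at a point: `σ₁` differentiable at `σ₂ g` with the section letter `D₁ (σ₁′ k) = k`, `V` differentiable at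
  `σ₁ (σ₂ g)`, `DV(σ₁ (σ₂ g))|_{ker D₁} = 0`, `D(V ∘ σ₁)(σ₂ g)|_{ker D₂} = 0` ⟹ `DV(σ₁ (σ₂ g))|_{ker (D₂ ∘ D₁)} = 0`),
  **`critical_comp_on`** (the same along charts `U₂ → U₁`: HSIC's conjunct (o) for the composite branch from the two steps' (o) and
  step 1's (a)), `hasFDerivAt_comp_branch` (`D(V ∘ σ₁ ∘ σ₂)(g) = DV(σ₁ σ₂ g) ∘ σ₁′ ∘ σ₂′`, the chain rule packaged in the step's shapes).
* §5 toys (`example`s on `ℝ`): the identity `(Q⁺)⁺ = Q[T₁T₂·, T₁T₂·]` for `Q = mul`; `kerCoercive_twoStep` with `D₁ = D₂ = T₁ = T₂ = 1`,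
  `D₃ = 0`, `m₃ = d = 1`; `critical_comp` for `V = id`, `σ₁ = σ₂ = id`, `D₁ = D₂ = 1` (vacuous kernel — a shape check).

NOT HERE (honest): the composite blocking's test sections, norms and three-scale coercivities BY VALUE for Bałaban's averaging
operators and small-field actions ((A3) ∕ (A1c), NC-NE7b-α UNRULED — F689's `x_B*`, `γ*` are the pricing desk's by-value numbers for
the free field, not used here); the existence of the composite chart with a radius (HSCR at the composite data — its Neumann margin
is a letter of the COMPOSITE, not derived from the steps'); the fluctuation integrals (the soft ∕ Gaussian semigroup is leaf-04's
`…SoftStepSemigroup` ∕ the tree's `…BIJ85ScalarFormSemigroup`); the `n`-step packaging (iterate this file); anything of Bałaban's.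
BY-NAME EFFECT ON THE WALL: NONE.  NE7b NOT PRINTED ∕ NOT PROVED; spine PROVED 0∕9; rung (B)+1 on a FINITE torus — NOT infinite
volume, NOT the mass gap, NOT Clay.  HONEST DEPENDENCY: continuum YM on T⁴ ⇐ BetaPertH ∧ nine spine estimates (0∕9 proved);
BetaPertH ⇐ (D1) ∧ (D4) ∧ CAP+tail; G-an2-4 gates asym, D1 and NE2∕3∕4.
-/

set_option autoImplicit false

namespace Summit.QuantumFields.BalabanUV.T4Continuum.NE7b.HardStepSemigroup

open Summit.QuantumFields.BalabanUV.T4Continuum.NE7b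

/-! ## §1. Composition: sections compose, transported forms compose, criticality composes -/

section Linear

variable {E F G : Type*} [NormedAddCommGroup E] [NormedSpace ℝ E] [NormedAddCommGroup F] [NormedSpace ℝ F]
  [NormedAddCommGroup G] [NormedSpace ℝ G]

/-- Sections compose: a section `T₁` of `D₁` and a section `T₂` of `D₂` give the section `T₁ ∘ T₂` of `D₂ ∘ D₁`. [folklore] -/
theorem section_comp {D₁ : E →L[ℝ] F} {D₂ : F →L[ℝ] G} {T₁ : F →L[ℝ] E} {T₂ : G →L[ℝ] F}
    (hT₁ : ∀ k, D₁ (T₁ k) = k) (hT₂ : ∀ g, D₂ (T₂ g) = g) (g : G) : (D₂.comp D₁) ((T₁.comp T₂) g) = g := by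
  simp only [ContinuousLinearMap.coe_comp, Function.comp_apply, hT₁, hT₂]

/-- **THE TWICE-TRANSPORTED FORM IS THE ONCE-TRANSPORTED FORM**: `(Q.bilinearComp T₁ T₁′).bilinearComp T₂ T₂′ =
Q.bilinearComp (T₁ ∘ T₂) (T₁′ ∘ T₂′)` — two hard steps' Hessian transport is one transport along the composite section. [folklore] -/
theorem bilinearComp_bilinearComp (Q : E →L[ℝ] E →L[ℝ] ℝ) (T₁ T₁' : F →L[ℝ] E) (T₂ T₂' : G →L[ℝ] F) :
    (Q.bilinearComp T₁ T₁').bilinearComp T₂ T₂' = Q.bilinearComp (T₁.comp T₂) (T₁'.comp T₂') := by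
  ext g g'
  simp only [ContinuousLinearMap.bilinearComp_apply, ContinuousLinearMap.coe_comp, Function.comp_apply]

/-- The two-step form's quadratic values: `(Q⁺)⁺ g g = Q (T₁ T₂ g) (T₁ T₂ g)`. [folklore] -/
theorem twoStep_quad_eq (Q : E →L[ℝ] E →L[ℝ] ℝ) (T₁ : F →L[ℝ] E) (T₂ : G →L[ℝ] F) (g g' : G) :
    ((Q.bilinearComp T₁ T₁).bilinearComp T₂ T₂) g g' = Q (T₁ (T₂ g)) (T₁ (T₂ g')) := by
  simp only [ContinuousLinearMap.bilinearComp_apply]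

/-- **CRITICALITY COMPOSES (first orthogonality letter).**  If `T₁` is a section of `D₁` whose values are `Q`-orthogonal to
`ker D₁` (`Q (T₁ k) κ = 0` for `D₁ κ = 0` — the critical section of the first step) and `T₂`'s values are `Q⁺`-orthogonal to `ker D₂`
for the transported form `Q⁺ = Q.bilinearComp T₁ T₁` (the critical section of the second step), then the values of `T₁ ∘ T₂` are
`Q`-orthogonal to `ker (D₂ ∘ D₁)`: split `x = (x − T₁ D₁ x) + T₁ D₁ x`, the first summand lies in `ker D₁`, the second is `T₁` of an
element of `ker D₂`. [folklore] -/
theorem orthogonal_ker_comp (Q : E →L[ℝ] E →L[ℝ] ℝ) {D₁ : E →L[ℝ] F} {D₂ : F →L[ℝ] G} {T₁ : F →L[ℝ] E} {T₂ : G →L[ℝ] F}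
    (hT₁ : ∀ k, D₁ (T₁ k) = k) (h₁ : ∀ k κ, D₁ κ = 0 → Q (T₁ k) κ = 0)
    (h₂ : ∀ g v, D₂ v = 0 → (Q.bilinearComp T₁ T₁) (T₂ g) v = 0) (g : G) (x : E) (hx : D₂ (D₁ x) = 0) :
    Q (T₁ (T₂ g)) x = 0 := by
  have hκ : D₁ (x - T₁ (D₁ x)) = 0 := by rw [map_sub, hT₁, sub_self]
  have e : Q (T₁ (T₂ g)) x = Q (T₁ (T₂ g)) (x - T₁ (D₁ x)) + Q (T₁ (T₂ g)) (T₁ (D₁ x)) := by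
    rw [map_sub, sub_add_cancel]
  rw [e, h₁ _ _ hκ, zero_add]
  have h := h₂ g (D₁ x) hx
  rwa [ContinuousLinearMap.bilinearComp_apply] at h

/-- Criticality composes (second orthogonality letter, for a non-symmetric `Q`): with `Q κ (T₁ k) = 0` on `ker D₁` and
`Q⁺ v (T₂ g) = 0` on `ker D₂`, `Q x (T₁ T₂ g) = 0` on `ker (D₂ ∘ D₁)`.  For a symmetric `Q` either letter gives the other. [folklore] -/
theorem orthogonal_ker_comp' (Q : E →L[ℝ] E →L[ℝ] ℝ) {D₁ : E →L[ℝ] F} {D₂ : F →L[ℝ] G} {T₁ : F →L[ℝ] E} {T₂ : G →L[ℝ] F}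
    (hT₁ : ∀ k, D₁ (T₁ k) = k) (h₁ : ∀ k κ, D₁ κ = 0 → Q κ (T₁ k) = 0)
    (h₂ : ∀ g v, D₂ v = 0 → (Q.bilinearComp T₁ T₁) v (T₂ g) = 0) (g : G) (x : E) (hx : D₂ (D₁ x) = 0) :
    Q x (T₁ (T₂ g)) = 0 := by
  have hκ : D₁ (x - T₁ (D₁ x)) = 0 := by rw [map_sub, hT₁, sub_self]
  have e : Q x (T₁ (T₂ g)) = Q (x - T₁ (D₁ x)) (T₁ (T₂ g)) + Q (T₁ (D₁ x)) (T₁ (T₂ g)) := by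
    rw [map_sub, sub_apply, sub_add_cancel]
  rw [e, h₁ _ _ hκ, zero_add]
  have h := h₂ g (D₁ x) hx
  rwa [ContinuousLinearMap.bilinearComp_apply] at h

end Linear

/-! ## §2. Uniqueness and factorisation: the two descriptions are one object (QFM BY NAME) -/

section Unique

variable {E F G : Type*} [NormedAddCommGroup E] [InnerProductSpace ℝ E] [NormedAddCommGroup F] [NormedSpace ℝ F]
  [NormedAddCommGroup G] [NormedSpace ℝ G]

/-- **THE COMPOSITE's CRITICAL SECTION IS `T₁ ∘ T₂`.**  If `Q` is `m`-coercive on `ker (D₂ ∘ D₁)`, ANY section `H` of `D₂ ∘ D₁`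
whose values are `Q`-orthogonal to `ker (D₂ ∘ D₁)` (e.g. QFM's propagator `exists_propagator` at the composite data) equals the
composite of the two steps' critical sections — QFM `propagator_unique` at `D := D₂ ∘ D₁`. [folklore] -/
theorem comp_eq_of_critical (Q : E →L[ℝ] E →L[ℝ] ℝ) {D₁ : E →L[ℝ] F} {D₂ : F →L[ℝ] G} {T₁ : F →L[ℝ] E} {T₂ : G →L[ℝ] F}
    (hT₁ : ∀ k, D₁ (T₁ k) = k) (h₁ : ∀ k κ, D₁ κ = 0 → Q (T₁ k) κ = 0) (hT₂ : ∀ g, D₂ (T₂ g) = g)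
    (h₂ : ∀ g v, D₂ v = 0 → (Q.bilinearComp T₁ T₁) (T₂ g) v = 0) {m : ℝ} (hm : 0 < m)
    (hco : ∀ x, D₂ (D₁ x) = 0 → m * ‖x‖ ^ 2 ≤ Q x x) {H : G →L[ℝ] E} (hH : ∀ g, D₂ (D₁ (H g)) = g)
    (hHo : ∀ g x, D₂ (D₁ x) = 0 → Q (H g) x = 0) : H = T₁.comp T₂ := by
  refine QuadraticFibreMinimiser.propagator_unique (D := D₂.comp D₁) hm (fun x hx => hco x (by simpa using hx))
    (fun g => by simpa using hH g) (fun g x hx => hHo g x (by simpa using hx)) (section_comp hT₁ hT₂) ?_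
  intro g x hx
  exact orthogonal_ker_comp Q hT₁ h₁ h₂ g x (by simpa using hx)

/-- **FACTORISATION THROUGH THE FIRST STEP.**  If `T₁` is the first step's critical section and `Q` is `m`-coercive on `ker D₁`,
then ANY map `T : G →L E` whose values are `Q`-orthogonal to `ker (D₂ ∘ D₁)` (in particular the composite's critical section)
satisfies `T = T₁ ∘ (D₁ ∘ T)`: `T g` and `T₁ (D₁ (T g))` lie in one `D₁`-fibre and are both `Q`-orthogonal to `ker D₁ ⊆ ker (D₂ ∘ D₁)`
— QFM `eq_of_orthogonal_ker`.  No section property of `T` is used. [folklore] -/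
theorem factor_through_first (Q : E →L[ℝ] E →L[ℝ] ℝ) {D₁ : E →L[ℝ] F} (D₂ : F →L[ℝ] G) {T₁ : F →L[ℝ] E}
    (hT₁ : ∀ k, D₁ (T₁ k) = k) (h₁ : ∀ k κ, D₁ κ = 0 → Q (T₁ k) κ = 0) {m : ℝ} (hm : 0 < m)
    (hco : ∀ κ, D₁ κ = 0 → m * ‖κ‖ ^ 2 ≤ Q κ κ) {T : G →L[ℝ] E} (hTo : ∀ g x, D₂ (D₁ x) = 0 → Q (T g) x = 0) :
    T = T₁.comp (D₁.comp T) := by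
  ext g
  simp only [ContinuousLinearMap.coe_comp, Function.comp_apply]
  refine QuadraticFibreMinimiser.eq_of_orthogonal_ker (D := D₁) hm hco (by rw [hT₁]) (fun κ hκ => hTo g κ ?_)
    (fun κ hκ => h₁ _ κ hκ)
  rw [hκ, map_zero]

/-- **THE SECOND STEP's SECTION FROM THE COMPOSITE's** (no Lax–Milgram at the intermediate scale): under the hypotheses of
`factor_through_first`, if `T` is moreover a section of `D₂ ∘ D₁`, then `T₂ := D₁ ∘ T` is a section of `D₂` whose values are
`Q⁺`-orthogonal to `ker D₂` for `Q⁺ = Q.bilinearComp T₁ T₁` — the second step's critical section — and `T = T₁ ∘ T₂`. [folklore] -/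
theorem second_section_of_composite (Q : E →L[ℝ] E →L[ℝ] ℝ) {D₁ : E →L[ℝ] F} (D₂ : F →L[ℝ] G) {T₁ : F →L[ℝ] E}
    (hT₁ : ∀ k, D₁ (T₁ k) = k) (h₁ : ∀ k κ, D₁ κ = 0 → Q (T₁ k) κ = 0) {m : ℝ} (hm : 0 < m)
    (hco : ∀ κ, D₁ κ = 0 → m * ‖κ‖ ^ 2 ≤ Q κ κ) {T : G →L[ℝ] E} (hT : ∀ g, D₂ (D₁ (T g)) = g)
    (hTo : ∀ g x, D₂ (D₁ x) = 0 → Q (T g) x = 0) :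
    (∀ g, D₂ ((D₁.comp T) g) = g) ∧ (∀ g v, D₂ v = 0 → (Q.bilinearComp T₁ T₁) ((D₁.comp T) g) v = 0) ∧
      T = T₁.comp (D₁.comp T) := by
  have hfac := factor_through_first Q D₂ hT₁ h₁ hm hco hTo
  refine ⟨fun g => by simpa using hT g, fun g v hv => ?_, hfac⟩
  rw [ContinuousLinearMap.bilinearComp_apply]
  have e : T₁ ((D₁.comp T) g) = T g := by
    have := congrArg (fun L : G →L[ℝ] E => L g) hfac
    simpa using this.symm
  rw [e]
  exact hTo g (T₁ v) (by rw [hT₁, hv])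

end Unique

/-! ## §3. One-shot letters for the two-step stretch (TFC ∕ QFM BY NAME, ONCE on the composite) -/

section OneShot

variable {E F G G' : Type*} [NormedAddCommGroup E] [NormedSpace ℝ E] [NormedAddCommGroup F] [NormedSpace ℝ F]
  [NormedAddCommGroup G] [NormedSpace ℝ G] [NormedAddCommGroup G'] [NormedSpace ℝ G']

/-- **THE TWO-STEP FORM's KERNEL COERCIVITY IN ONE SHOT**: `Q` `m₃`-coercive on `ker (D₃ ∘ D₂ ∘ D₁)` (a three-scale letter of `Q`
ITSELF), `‖D₂ (D₁ x)‖ ≤ d‖x‖` with `0 < d` ⟹ `(Q⁺)⁺ = (Q.bilinearComp T₁ T₁).bilinearComp T₂ T₂` is `(m₃∕d²)`-coercive on `ker D₃` —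
TFC `kerCoercive_bilinearComp_div` ONCE at `(D, S, D⁺) := (D₂ ∘ D₁, T₁ ∘ T₂, D₃)`; only the section letters of `T₁`, `T₂` are used. [folklore] -/
theorem kerCoercive_twoStep (Q : E →L[ℝ] E →L[ℝ] ℝ) {D₁ : E →L[ℝ] F} {D₂ : F →L[ℝ] G} {T₁ : F →L[ℝ] E} {T₂ : G →L[ℝ] F}
    (hT₁ : ∀ k, D₁ (T₁ k) = k) (hT₂ : ∀ g, D₂ (T₂ g) = g) (D₃ : G →L[ℝ] G') {m₃ : ℝ} (hm₃ : 0 ≤ m₃)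
    (hco₃ : ∀ x, D₃ (D₂ (D₁ x)) = 0 → m₃ * ‖x‖ ^ 2 ≤ Q x x) {d : ℝ} (hd0 : 0 < d) (hd : ∀ x, ‖D₂ (D₁ x)‖ ≤ d * ‖x‖) :
    ∀ g, D₃ g = 0 → m₃ / d ^ 2 * ‖g‖ ^ 2 ≤ ((Q.bilinearComp T₁ T₁).bilinearComp T₂ T₂) g g := by
  intro g hg
  rw [bilinearComp_bilinearComp]
  exact TransportedFormCoercivity.kerCoercive_bilinearComp_div (D := D₂.comp D₁) (S := T₁.comp T₂) (section_comp hT₁ hT₂) D₃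
    hm₃ (fun x hx => hco₃ x (by simpa using hx)) hd0 (fun x => by simpa using hd x) g hg

/-- The default norm letter of the composite blocking: `‖D₂ (D₁ x)‖ ≤ ‖D₂‖‖D₁‖‖x‖`. [folklore] -/
theorem norm_comp_comp_le (D₁ : E →L[ℝ] F) (D₂ : F →L[ℝ] G) (x : E) : ‖D₂ (D₁ x)‖ ≤ ‖D₂‖ * ‖D₁‖ * ‖x‖ := by
  calc ‖D₂ (D₁ x)‖ ≤ ‖D₂‖ * ‖D₁ x‖ := D₂.le_opNorm _
    _ ≤ ‖D₂‖ * (‖D₁‖ * ‖x‖) := mul_le_mul_of_nonneg_left (D₁.le_opNorm x) (norm_nonneg _)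
    _ = ‖D₂‖ * ‖D₁‖ * ‖x‖ := by ring

end OneShot

section OneShotIP

variable {E F G : Type*} [NormedAddCommGroup E] [InnerProductSpace ℝ E] [NormedAddCommGroup F] [NormedSpace ℝ F]
  [NormedAddCommGroup G] [NormedSpace ℝ G]

/-- **THE TWO-STEP FORM's SIZE THROUGH ONE TEST SECTION OF THE COMPOSITE**: `Q` symmetric and `≥ 0` on `ker (D₂ ∘ D₁)`, the two
steps' critical sections `T₁`, `T₂` (section + first orthogonality letters), and ANY section `S` of `D₂ ∘ D₁` with the energy letter
`Q (S g) (S g) ≤ C‖g‖²` ⟹ `(Q⁺)⁺ g g ≤ C‖g‖²` — QFM `le_of_orthogonal_ker` ONCE on the composite fibre (THEC's END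
`opNorm_transportedHessian_le_of_testSection` then reads `‖(Q⁺)⁺‖ ≤ C` in an inner-product `G`). [folklore] -/
theorem twoStep_quad_le_of_testSection (Q : E →L[ℝ] E →L[ℝ] ℝ) {D₁ : E →L[ℝ] F} {D₂ : F →L[ℝ] G} {T₁ : F →L[ℝ] E}
    {T₂ : G →L[ℝ] F} (hT₁ : ∀ k, D₁ (T₁ k) = k) (h₁ : ∀ k κ, D₁ κ = 0 → Q (T₁ k) κ = 0) (hT₂ : ∀ g, D₂ (T₂ g) = g)
    (h₂ : ∀ g v, D₂ v = 0 → (Q.bilinearComp T₁ T₁) (T₂ g) v = 0) (hsymm : ∀ x y, Q x y = Q y x)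
    (hpos : ∀ x, D₂ (D₁ x) = 0 → 0 ≤ Q x x) (S : G →L[ℝ] E) (hS : ∀ g, D₂ (D₁ (S g)) = g) {C : ℝ}
    (hC : ∀ g, Q (S g) (S g) ≤ C * ‖g‖ ^ 2) (g : G) :
    ((Q.bilinearComp T₁ T₁).bilinearComp T₂ T₂) g g ≤ C * ‖g‖ ^ 2 := by
  rw [twoStep_quad_eq]
  refine (QuadraticFibreMinimiser.le_of_orthogonal_ker (D := D₂.comp D₁) hsymm (fun x hx => hpos x (by simpa using hx))
    (x := S g) (h := T₁ (T₂ g)) ?_ ?_).trans (hC g)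
  · have := section_comp (D₁ := D₁) (D₂ := D₂) hT₁ hT₂ g
    simp only [ContinuousLinearMap.coe_comp, Function.comp_apply] at this ⊢
    rw [this, hS]
  · intro x hx
    exact orthogonal_ker_comp Q hT₁ h₁ h₂ g x (by simpa using hx)

/-- **THE COMPOSITE CHART CONSTANT IN ONE SHOT**: `Q` `m`-coercive on `ker (D₂ ∘ D₁)` and ANY right inverse `M` of `D₂ ∘ D₁` give
`‖T₁ ∘ T₂‖ ≤ (1 + ‖Q‖∕m)·‖M‖` — QFM `norm_le_of_orthogonal_ker` ONCE at the composite, in place of the product of the two steps'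
chart constants. [folklore] -/
theorem opNorm_comp_le_of_rightInverse (Q : E →L[ℝ] E →L[ℝ] ℝ) {D₁ : E →L[ℝ] F} {D₂ : F →L[ℝ] G} {T₁ : F →L[ℝ] E}
    {T₂ : G →L[ℝ] F} (hT₁ : ∀ k, D₁ (T₁ k) = k) (h₁ : ∀ k κ, D₁ κ = 0 → Q (T₁ k) κ = 0) (hT₂ : ∀ g, D₂ (T₂ g) = g)
    (h₂ : ∀ g v, D₂ v = 0 → (Q.bilinearComp T₁ T₁) (T₂ g) v = 0) {m : ℝ} (hm : 0 < m)
    (hco : ∀ x, D₂ (D₁ x) = 0 → m * ‖x‖ ^ 2 ≤ Q x x) {M : G →L[ℝ] E} (hM : ∀ g, D₂ (D₁ (M g)) = g) :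
    ‖T₁.comp T₂‖ ≤ (1 + ‖Q‖ / m) * ‖M‖ := by
  refine ContinuousLinearMap.opNorm_le_bound _ (by positivity) fun g => ?_
  have h := QuadraticFibreMinimiser.norm_le_of_orthogonal_ker (D := D₂.comp D₁) (M := M) (fun g => by simpa using hM g) hm
    (fun x hx => hco x (by simpa using hx)) (h := (T₁.comp T₂) g) (k := g) (section_comp hT₁ hT₂ g)
    (fun x hx => orthogonal_ker_comp Q hT₁ h₁ h₂ g x (by simpa using hx))
  calc ‖(T₁.comp T₂) g‖ ≤ (1 + ‖Q‖ / m) * ‖M g‖ := h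
    _ ≤ (1 + ‖Q‖ / m) * (‖M‖ * ‖g‖) := mul_le_mul_of_nonneg_left (M.le_opNorm g) (by positivity)
    _ = (1 + ‖Q‖ / m) * ‖M‖ * ‖g‖ := by ring

end OneShotIP

/-! ## §4. Nonlinear: constrained criticality composes through the chain rule -/

section Nonlinear

variable {E F G : Type*} [NormedAddCommGroup E] [NormedSpace ℝ E] [NormedAddCommGroup F] [NormedSpace ℝ F]
  [NormedAddCommGroup G] [NormedSpace ℝ G]

/-- Fibres compose: `σ₁` runs over the fibres of `D₁` on `U₁`, `σ₂` over the fibres of `D₂` on `U₂`, `σ₂ (U₂) ⊆ U₁` ⟹ `σ₁ ∘ σ₂`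
runs over the fibres of `D₂ ∘ D₁` on `U₂`. [folklore] -/
theorem fibre_comp {D₁ : E →L[ℝ] F} {D₂ : F →L[ℝ] G} {σ₁ : F → E} {σ₂ : G → F} {U₁ : Set F} {U₂ : Set G}
    (hσ₁ : ∀ w ∈ U₁, D₁ (σ₁ w) = w) (hσ₂ : ∀ g ∈ U₂, D₂ (σ₂ g) = g) (hmaps : Set.MapsTo σ₂ U₂ U₁) {g : G}
    (hg : g ∈ U₂) : D₂ (D₁ (σ₁ (σ₂ g))) = g := by
  rw [hσ₁ _ (hmaps hg), hσ₂ _ hg]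

/-- The composite branch's derivative is the composite of the derivatives and is a section of `D₂ ∘ D₁` (chain rule + the two
section letters). [folklore] -/
theorem section_fderiv_comp {D₁ : E →L[ℝ] F} {D₂ : F →L[ℝ] G} {σ₁ : F → E} {σ₂ : G → F} {g : G}
    (hσ₁d : DifferentiableAt ℝ σ₁ (σ₂ g)) (hσ₂d : DifferentiableAt ℝ σ₂ g)
    (hsec₁ : ∀ k, D₁ (fderiv ℝ σ₁ (σ₂ g) k) = k) (hsec₂ : ∀ h, D₂ (fderiv ℝ σ₂ g h) = h) (h : G) :
    fderiv ℝ (σ₁ ∘ σ₂) g = (fderiv ℝ σ₁ (σ₂ g)).comp (fderiv ℝ σ₂ g) ∧ D₂ (D₁ (fderiv ℝ (σ₁ ∘ σ₂) g h)) = h := by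
  have hc : fderiv ℝ (σ₁ ∘ σ₂) g = (fderiv ℝ σ₁ (σ₂ g)).comp (fderiv ℝ σ₂ g) := fderiv_comp g hσ₁d hσ₂d
  refine ⟨hc, ?_⟩
  rw [hc, ContinuousLinearMap.coe_comp, Function.comp_apply, hsec₁, hsec₂]

/-- **CONSTRAINED CRITICALITY COMPOSES (at a point).**  `σ₁` differentiable at `σ₂ g` with the section letter `D₁ (σ₁′ k) = k`, `V`
differentiable at `σ₁ (σ₂ g)`, the first step's criticality `DV(σ₁ (σ₂ g)) κ = 0` for `D₁ κ = 0` and the second step's criticality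
`D(V ∘ σ₁)(σ₂ g) v = 0` for `D₂ v = 0` ⟹ `DV(σ₁ (σ₂ g)) x = 0` for EVERY `x` with `D₂ (D₁ x) = 0`: split `x = (x − σ₁′ D₁ x) + σ₁′ D₁ x`,
the first summand is in `ker D₁`, on the second the chain rule turns `DV ∘ σ₁′` into `D(V ∘ σ₁)`. [folklore] -/
theorem critical_comp {V : E → ℝ} {D₁ : E →L[ℝ] F} {D₂ : F →L[ℝ] G} {σ₁ : F → E} {σ₂ : G → F} {g : G}
    (hσ₁d : DifferentiableAt ℝ σ₁ (σ₂ g)) (hVd : DifferentiableAt ℝ V (σ₁ (σ₂ g)))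
    (hsec₁ : ∀ k, D₁ (fderiv ℝ σ₁ (σ₂ g) k) = k)
    (hcrit₁ : ∀ κ, D₁ κ = 0 → fderiv ℝ V (σ₁ (σ₂ g)) κ = 0)
    (hcrit₂ : ∀ v, D₂ v = 0 → fderiv ℝ (V ∘ σ₁) (σ₂ g) v = 0) (x : E) (hx : D₂ (D₁ x) = 0) :
    fderiv ℝ V (σ₁ (σ₂ g)) x = 0 := by
  have hchain : fderiv ℝ (V ∘ σ₁) (σ₂ g) = (fderiv ℝ V (σ₁ (σ₂ g))).comp (fderiv ℝ σ₁ (σ₂ g)) :=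
    fderiv_comp (σ₂ g) hVd hσ₁d
  have hκ : D₁ (x - fderiv ℝ σ₁ (σ₂ g) (D₁ x)) = 0 := by rw [map_sub, hsec₁, sub_self]
  have e : fderiv ℝ V (σ₁ (σ₂ g)) x =
      fderiv ℝ V (σ₁ (σ₂ g)) (x - fderiv ℝ σ₁ (σ₂ g) (D₁ x)) + fderiv ℝ V (σ₁ (σ₂ g)) (fderiv ℝ σ₁ (σ₂ g) (D₁ x)) := by
    rw [map_sub, sub_add_cancel]
  rw [e, hcrit₁ _ hκ, zero_add]
  have h2 := hcrit₂ (D₁ x) hx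
  rw [hchain] at h2
  simpa using h2

/-- **CONSTRAINED CRITICALITY COMPOSES ALONG CHARTS** — HSIC's conjunct (o) for the composite branch `σ₁ ∘ σ₂` on `U₂` from step 1's
(o) + (a) on `U₁` and step 2's (o) on `U₂`, `σ₂ (U₂) ⊆ U₁`: `∀ g ∈ U₂, ∀ x, D₂ (D₁ x) = 0 → DV(σ₁ (σ₂ g)) x = 0`. [folklore] -/
theorem critical_comp_on {V : E → ℝ} {D₁ : E →L[ℝ] F} {D₂ : F →L[ℝ] G} {σ₁ : F → E} {σ₂ : G → F} {U₁ : Set F} {U₂ : Set G}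
    (hmaps : Set.MapsTo σ₂ U₂ U₁) (hσ₁d : ∀ w ∈ U₁, DifferentiableAt ℝ σ₁ w)
    (hVd : ∀ w ∈ U₁, DifferentiableAt ℝ V (σ₁ w)) (hsec₁ : ∀ w ∈ U₁, ∀ k, D₁ (fderiv ℝ σ₁ w k) = k)
    (hcrit₁ : ∀ w ∈ U₁, ∀ κ, D₁ κ = 0 → fderiv ℝ V (σ₁ w) κ = 0)
    (hcrit₂ : ∀ g ∈ U₂, ∀ v, D₂ v = 0 → fderiv ℝ (V ∘ σ₁) (σ₂ g) v = 0) :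
    ∀ g ∈ U₂, ∀ x, D₂ (D₁ x) = 0 → fderiv ℝ V ((σ₁ ∘ σ₂) g) x = 0 :=
  fun g hg x hx => critical_comp (hσ₁d _ (hmaps hg)) (hVd _ (hmaps hg)) (hsec₁ _ (hmaps hg)) (hcrit₁ _ (hmaps hg))
    (hcrit₂ g hg) x hx

/-- The two-step action's derivative in the step's shapes: `HasFDerivAt (V ∘ σ₁ ∘ σ₂) (DV(σ₁ σ₂ g) ∘ σ₁′(σ₂ g) ∘ σ₂′(g)) g` (the
chain rule twice; with `bilinearComp_bilinearComp` the two-step next Hessian of HSIS (c) is `V″(σ₁σ₂ g).bilinearComp ((σ₁∘σ₂)′ g)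
((σ₁∘σ₂)′ g)`). [folklore] -/
theorem hasFDerivAt_comp_branch {V : E → ℝ} {V' : E →L[ℝ] ℝ} {σ₁ : F → E} {S₁ : F →L[ℝ] E} {σ₂ : G → F} {S₂ : G →L[ℝ] F}
    {g : G} (hV : HasFDerivAt V V' (σ₁ (σ₂ g))) (hσ₁ : HasFDerivAt σ₁ S₁ (σ₂ g)) (hσ₂ : HasFDerivAt σ₂ S₂ g) :
    HasFDerivAt (V ∘ σ₁ ∘ σ₂) ((V'.comp S₁).comp S₂) g :=
  (hV.comp (σ₂ g) hσ₁).comp g hσ₂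

end Nonlinear

/-! ## §5. Toys -/

/-- Toy: on `ℝ` with `Q = mul` and `T₁ = T₂ = 1`, the twice-transported form is `mul` transported once along `1 ∘ 1`. -/
example : ((ContinuousLinearMap.mul ℝ ℝ).bilinearComp (ContinuousLinearMap.id ℝ ℝ) (ContinuousLinearMap.id ℝ ℝ)).bilinearComp
      (ContinuousLinearMap.id ℝ ℝ) (ContinuousLinearMap.id ℝ ℝ) =
    (ContinuousLinearMap.mul ℝ ℝ).bilinearComp ((ContinuousLinearMap.id ℝ ℝ).comp (ContinuousLinearMap.id ℝ ℝ))
      ((ContinuousLinearMap.id ℝ ℝ).comp (ContinuousLinearMap.id ℝ ℝ)) :=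
  bilinearComp_bilinearComp _ _ _ _ _

/-- Toy (non-vacuity of §3's letter list): `E = F = G = G′ = ℝ`, `Q = mul`, `D₁ = D₂ = T₁ = T₂ = 1`, `D₃ = 0`, `m₃ = d = 1`:
`kerCoercive_twoStep` returns `1∕1²·‖g‖² ≤ g·g` on `ker 0 = ℝ`. -/
example (g : ℝ) : (1 : ℝ) / 1 ^ 2 * ‖g‖ ^ 2 ≤
    (((ContinuousLinearMap.mul ℝ ℝ).bilinearComp (ContinuousLinearMap.id ℝ ℝ) (ContinuousLinearMap.id ℝ ℝ)).bilinearComp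
      (ContinuousLinearMap.id ℝ ℝ) (ContinuousLinearMap.id ℝ ℝ)) g g :=
  kerCoercive_twoStep (ContinuousLinearMap.mul ℝ ℝ) (D₁ := ContinuousLinearMap.id ℝ ℝ) (D₂ := ContinuousLinearMap.id ℝ ℝ)
    (fun _ => rfl) (fun _ => rfl) (0 : ℝ →L[ℝ] ℝ) zero_le_one
    (fun x _ => by rw [ContinuousLinearMap.mul_apply', one_mul, Real.norm_eq_abs, sq_abs, sq])
    one_pos (fun x => by simp) g (by simp)

/-- Toy (shape check of §4): `V = id`-like data with trivial kernels — `D₁ = D₂ = 1`, `σ₁ = σ₂ = id` on `ℝ`: the composite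
criticality letter holds (vacuously in `x`, since `ker (1 ∘ 1) = 0`). -/
example (V : ℝ → ℝ) (hV : Differentiable ℝ V) (g x : ℝ)
    (hx : (ContinuousLinearMap.id ℝ ℝ) ((ContinuousLinearMap.id ℝ ℝ) x) = 0) : fderiv ℝ V (id (id g)) x = 0 :=
  critical_comp (D₁ := ContinuousLinearMap.id ℝ ℝ) (D₂ := ContinuousLinearMap.id ℝ ℝ) (σ₁ := id) (σ₂ := id)
    differentiableAt_id (hV _) (fun k => by simp [fderiv_id]) (fun κ hκ => by simp at hκ; simp [hκ])
    (fun v hv => by simp at hv; simp [hv]) x hx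

end Summit.QuantumFields.BalabanUV.T4Continuum.NE7b.HardStepSemigroup
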